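import Literature.MathematicalPhysics.QuantumFieldTheory.SchroderVuorinen2005.ThreeLoopTadpoles
import Literature.MathematicalPhysics.QuantumFieldTheory.LeeMarquardSmirnovSmirnovSteinhauser2013.FourLoopOnShellMasters
import HarnessLib

/-!
# Γ-closed forms made kernel data: the exp–log ε-expansion of products of Γ-functions, and kernel checks that the
# PRINTED Γ-closed forms of Lee–Smirnov 2011 (`G_{4,1}, G_{4,2}, G_{4,4}, G_{5,4}`), Schröder–Vuorinen 2005 (`threeBa`),
# Badger–Henn–Plefka–Zoia 2024 (one-loop `F₃`) reproduce the PRINTED ε-expansions, and that the hand-typed conversion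
# factor `(e^{−γε}/Γ(1+ε))⁴` of the Lee–Marquard–Smirnov–Smirnov–Steinhauser 2013 file is the exp–log series

CITATION HEADER (venture `QEDPrecision`, cell `qed-ibp`, seat `qed-ibp-lit`; typed PUBLISHED statements only — this file asserts no
physics; it turns three classical identities of analysis into a small exact-arithmetic engine and proves, by kernel evaluation, that
several printed closed forms and printed expansions are consistent with each other).

THE THREE IDENTITIES THE ENGINE ENCODES (as formal power series; they are the CONTENT of the `def`s below, cited, not proved here):
* `log Γ(1+x) = −γ_E x + Σ_{n≥2} (−1)^n ζ_n x^n / n` for `|x| < 1` [BadgerEtAl2024, eq. (4.24); AbramowitzStegun1964, 6.1.33];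
* `log (Γ(½+x)/Γ(½)) = −(γ_E + 2 ln 2) x + Σ_{n≥2} (−1)^n (2^n − 1) ζ_n x^n / n` (from `ψ(½) = −γ_E − 2 ln 2` and
  `ψ^{(n)}(½) = (−1)^{n+1} n! (2^{n+1} − 1) ζ(n+1)` [AbramowitzStegun1964, 6.3.3 and 6.4.4]);
* `ζ_2 = π²/6, ζ_4 = π⁴/90, ζ_6 = π⁶/945, ζ_8 = π⁸/9450` (Euler; [AbramowitzStegun1964, 23.2.16 and Table 23.3]; `ζ_2, ζ_4` also
  [BadgerEtAl2024, text after eq. (4.26)]); odd `ζ_3, ζ_5, ζ_7` stay as the symbols of [LeeSmirnov2011]'s `Mono`.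
Together with `Γ(x+1) = xΓ(x)` [BadgerEtAl2024, eq. (4.23)] every finite product `Π_i Γ(a_i + c_i ε)^{s_i} · 2^{a+cε} · e^{cγ_E ε}`
with `a_i ∈ ½ℤ`, `c_i ∈ ℤ` in which `γ_E` cancels is `ε^{shift} × (rational Laurent-free series) × exp(L(ε))` with `L` a series in
`ln 2, π², ζ₃, …` — computed below by `gammaFormSeries` EXACTLY (ℚ-coefficients of monomials), truncated at order `N ≤ 8` past the
leading power (the ζ-table stops at `ζ_8`; the theorems use `N = 7`).

WHAT IS TYPED (data, as printed): `lsGammaForm` — the four Γ-closed forms printed in [LeeSmirnov2011] §3 (the `ThreeLoopMastersAnalytic`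
file types only their rational prefactors and brackets); `svThreeBaForm` — [SchroderVuorinen2005] eq. for `threeBa/J³` (TeX l.1360–1362) as
a function of `d`; `badgerF3Form`/`badgerF3Bracket` — [BadgerEtAl2024] eqs. (4.21), (4.27).

WHAT IS PROVED (kernel evaluation, `decide +kernel`):
* `ls_gamma_forms_reproduce_brackets` — for `G_{4,1}` (`ε⁻²…ε⁵`), `G_{4,2}`, `G_{4,4}`, `G_{5,4}` (`ε⁻³…ε⁴`): the exp–log expansion of
  the printed Γ-product, divided by `Γ(1+ε)³`, equals the printed `prefactor × {bracket}` at EVERY printed order (32 coefficients, weights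
  ≤ 7: `π⁶, ζ₃², π⁴ζ₃, π²ζ₅, ζ₇` included). In particular the cell's de seat's «Γ-derived» routes for LR1996's `I₁₄ = G_{4,4}/Γ³` and
  `I₁₆ = G_{4,2}/Γ³` rest on printed closed forms that the kernel has now expanded.
* `sv_threeBa_form_is_ls_g44` — [SchroderVuorinen2005]'s printed `d`-dimensional Γ-form of the 2-massive + 2-massless three-loop
  banana, read at `d = 4 − 2ε` and multiplied by `J³ ↦ Γ(ε−1)³`, expands to [LeeSmirnov2011]'s `G_{4,4}` through all eight printed orders
  (the identification `threeBa = G_{4,4}` that `ThreeLoopTadpoles.lean` had checked «outside Lean» is now a kernel fact).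
* `lmsss_convFactor4_is_explog` — the conversion factor `(e^{−γ_Eε}/Γ(1+ε))⁴` hand-typed through `ε⁷` in
  `FourLoopOnShellMasters.lean` IS the exp–log series (so that file's `mCell_eq` now rests on kernel-computed, not hand-typed, data).
* `badger_F3_expansion` — the textbook's worked example: `e^{εγ_E}Γ(1+ε)Γ(−ε)²/Γ(1−2ε) = ε⁻² − π²/12 − (7/3)ζ₃ε − (47/1440)π⁴ε² + O(ε³)`.
* `euler_cancels` — in each of the seven products above the coefficient of `γ_E ε` in the exponent is exactly zero (the engine refuses
  (`none`) otherwise); `reflection_check` — `Γ(1+ε)Γ(1−ε) = πε/sin(πε)` through `ε⁶`; `ls_g44_form_is_not_g42` — a non-vacuity control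
  (the comparison is `false` against the wrong bracket).
Deliberately NOT here: `Real.Gamma` (Mathlib) and any analytic statement about it — the bridge from `Real.Gamma` to these formal series
(Taylor's theorem for `log Γ`, Euler's even zeta values beyond `ζ₂, ζ₄` which Mathlib has) is not attempted; values of integrals; orders
needing `ζ_9` or higher. 0 unproved facts.
-/

namespace Literature.MathematicalPhysics.QuantumFieldTheory.LeeSmirnov2011

open LeeMarquardSmirnovSmirnovSteinhauser2013 (collect scoeffMul coeffAt convFactor4)
open SchroderVuorinen2005 (scEquiv coeffAgree)

/-! ### 1. Exact power-series arithmetic on the `SCoeff` containers (orders `0 … N`, list index = order) -/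

/-- A truncated power series `Σ_{k=0}^{N} c_k ε^k` with `SCoeff` coefficients (index = order). [cite: LeeSmirnov2011, §3 (the containers)] -/
abbrev PSer := List SCoeff

/-- Coefficient of `ε^k` of a truncated series (`[]` = 0 beyond the list). [cite: LeeSmirnov2011, §3] -/
def cf (p : PSer) (k : ℕ) : SCoeff := p.getD k []

/-- The zero series to order `N`. [cite: LeeSmirnov2011, §3] -/
def psZero (N : ℕ) : PSer := (List.range (N + 1)).map fun (_ : ℕ) => ([] : SCoeff)

/-- The constant series `1` to order `N`. [cite: LeeSmirnov2011, §3] -/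
def psOne (N : ℕ) : PSer := (List.range (N + 1)).map fun (k : ℕ) => if k = 0 then [((1 : ℚ), ({} : Mono))] else []

/-- Sum, truncated at order `N`, coefficients collected. [cite: LeeSmirnov2011, §3] -/
def psAdd (N : ℕ) (a b : PSer) : PSer := (List.range (N + 1)).map fun k => collect (cf a k ++ cf b k)

/-- Rational multiple. [cite: LeeSmirnov2011, §3] -/
def psScale (q : ℚ) (a : PSer) : PSer := a.map (SCoeff.smul q)

/-- Cauchy product truncated at order `N`, coefficients collected (monomials multiplied by `scoeffMul`). [cite: LeeSmirnov2011, §3] -/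
def psMul (N : ℕ) (a b : PSer) : PSer :=
  (List.range (N + 1)).map fun k => collect ((List.range (k + 1)).flatMap fun i => scoeffMul (cf a i) (cf b (k - i)))

/-- Product of a rational power series (coefficient list from order 0) with a `PSer`, truncated at `N`. [cite: LeeSmirnov2011, §3] -/
def psMulRat (N : ℕ) (r : List ℚ) (a : PSer) : PSer :=
  (List.range (N + 1)).map fun k => collect ((List.range (k + 1)).flatMap fun i => SCoeff.smul (r.getD i 0) (cf a (k - i)))

/-- `L^m` truncated at order `N`. [cite: LeeSmirnov2011, §3] -/
def psPow (N : ℕ) (L : PSer) : ℕ → PSer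
  | 0 => psOne N
  | m + 1 => psMul N L (psPow N L m)

/-- `exp L = Σ_{m=0}^{N} L^m/m!` truncated at order `N` — exact when `L` has no constant term (all uses below). [folklore] -/
def psExp (N : ℕ) (L : PSer) : PSer :=
  (List.range (N + 1)).foldr (fun m acc => psAdd N (psScale (1 / (Nat.factorial m : ℚ)) (psPow N L m)) acc) (psZero N)

/-- `q^p` for an integer exponent, by cases on the sign (kept elementary for kernel evaluation). [folklore] -/
def qzpow (q : ℚ) (p : ℤ) : ℚ := if p ≥ 0 then q ^ p.toNat else (1 / q) ^ (-p).toNat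

/-! ### 2. The ζ-table and the log-Γ series (the three classical identities, encoded) -/

/-- `ζ_k` as a printed-constant monomial: even `k ≤ 8` by Euler's `ζ_2 = π²/6, ζ_4 = π⁴/90, ζ_6 = π⁶/945, ζ_8 = π⁸/9450`; odd `k ≤ 7`
the symbols `ζ₃, ζ₅, ζ₇`; `[]` (i.e. unsupported — a documented junk value) for `k ≥ 9`, which is why every use keeps `N ≤ 8`.
[cite: AbramowitzStegun1964, 23.2.16 and Table 23.3] -/
def zetaSC : ℕ → SCoeff
  | 2 => [((1/6 : ℚ), { pi := 2 })]
  | 3 => [((1 : ℚ), { z3 := 1 })]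
  | 4 => [((1/90 : ℚ), { pi := 4 })]
  | 5 => [((1 : ℚ), { z5 := 1 })]
  | 6 => [((1/945 : ℚ), { pi := 6 })]
  | 7 => [((1 : ℚ), { z7 := 1 })]
  | 8 => [((1/9450 : ℚ), { pi := 8 })]
  | _ => []

/-- The γ_E-free part of `s · log Γ(1 + cε)` to order `N`: `Σ_{k=2}^{N} s(−1)^k c^k ζ_k/k · ε^k`
(`log Γ(1+x) = −γ_E x + Σ_{n≥2}(−1)^n ζ_n x^n/n`). [cite: BadgerEtAl2024, eq. (4.24)] -/
def logGammaOne (N : ℕ) (c : ℚ) (s : ℤ) : PSer :=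
  (List.range (N + 1)).map fun (k : ℕ) =>
    if k < 2 then [] else SCoeff.smul ((s : ℚ) * (-1 : ℚ) ^ k * c ^ k / ((k : ℕ) : ℚ)) (zetaSC k)

/-- The γ_E-free part of `s · log (Γ(½ + cε)/Γ(½))` to order `N`: `−2 ln 2 · s c ε + Σ_{k=2}^{N} s(−1)^k (2^k − 1) c^k ζ_k/k · ε^k`
(from `ψ(½) = −γ_E − 2 ln 2`, `ψ^{(n)}(½) = (−1)^{n+1} n! (2^{n+1}−1) ζ(n+1)`). [cite: AbramowitzStegun1964, 6.3.3 and 6.4.4] -/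
def logGammaHalf (N : ℕ) (c : ℚ) (s : ℤ) : PSer :=
  (List.range (N + 1)).map fun (k : ℕ) =>
    if k = 0 then []
    else if k = 1 then [((-2 : ℚ) * (s : ℚ) * c, { ln2 := 1 })]
    else SCoeff.smul ((s : ℚ) * (-1 : ℚ) ^ k * ((2 : ℚ) ^ k - 1) * c ^ k / ((k : ℕ) : ℚ)) (zetaSC k)

/-! ### 3. Factors, the normalisation `Γ(a + cε) = (linear factors) · Γ(1 + cε)` resp. `· Γ(½ + cε)`, and the engine -/

/-- One factor of a Γ-closed form: `gam t c s` = `Γ(t/2 + c ε)^s` (`t` even: integer argument; `t` odd: half-integer argument),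
`twoPow a c` = `2^{a + cε}`, `expEuler c` = `e^{c γ_E ε}`, `const q` = the rational `q`.
[cite: LeeSmirnov2011, §3, displays for G_{4,1}, G_{4,2}, G_{4,4}, G_{5,4}] -/
inductive GFactor where
  | gam (twiceShift : ℤ) (slope : ℤ) (pow : ℤ)
  | twoPow (a : ℤ) (c : ℤ)
  | expEuler (c : ℤ)
  | const (q : ℚ)
  deriving DecidableEq, Repr

/-- Accumulator of the engine: `ε^{shift} · scale · Π(num linear factors)/Π(den linear factors) · exp(euler·γ_E ε + logT)`.
[cite: LeeSmirnov2011, §3] -/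
structure GState where
  shift : ℤ
  scale : ℚ
  num : List (ℚ × ℚ)
  den : List (ℚ × ℚ)
  euler : ℚ
  logT : PSer

/-- The integers `a, a+1, …, b` (empty if `b < a`). [folklore] -/
def intRange (a b : ℤ) : List ℤ := (List.range (b + 1 - a).toNat).map fun i => a + (i : ℤ)

/-- Multiply the state by the linear factor `(q₀ + q₁ε)^p`: a pure power of `ε` when `q₀ = 0` (shift and scale), else a numerator
(`p > 0`) or denominator (`p < 0`) factor repeated `|p|` times. [cite: BadgerEtAl2024, eq. (4.23)] -/
def GState.mulLin (st : GState) (q₀ q₁ : ℚ) (p : ℤ) : GState :=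
  if q₀ = 0 then { st with shift := st.shift + p, scale := st.scale * qzpow q₁ p }
  else if p ≥ 0 then { st with num := st.num ++ (List.range p.toNat).map fun _ => (q₀, q₁) }
  else { st with den := st.den ++ (List.range (-p).toNat).map fun _ => (q₀, q₁) }

/-- Fold a list of linear factors `(j + r + cε)^p`, `j` over an integer range, into the state. [cite: BadgerEtAl2024, eq. (4.23)] -/
def GState.mulLins (st : GState) (js : List ℤ) (r c : ℚ) (p : ℤ) : GState :=
  js.foldl (fun acc j => acc.mulLin ((j : ℚ) + r) c p) st

/-- One factor into the state (truncation order `N`). For `Γ(n + cε)^s`: `Γ(n+cε) = Γ(1+cε)·Π_{j=1}^{n−1}(j+cε)` (`n ≥ 1`),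
`= Γ(1+cε)/Π_{j=n}^{0}(j+cε)` (`n ≤ 0`); for `Γ(n+½+cε)^s`: `Γ(n+½+cε) = Γ(½+cε)·Π_{j=0}^{n−1}(j+½+cε)` (`n ≥ 1`),
`= Γ(½+cε)/Π_{j=n}^{−1}(j+½+cε)` (`n ≤ −1`); the constant `Γ(½)^s` is DROPPED (every use below has as many half-integer Γ's
upstairs as downstairs — `halfBalance` checks it); the γ_E coefficient `−s c` and the ζ-series are accumulated.
[cite: BadgerEtAl2024, eqs. (4.23)–(4.24); AbramowitzStegun1964, 6.3.3, 6.4.4] -/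
def GState.step (N : ℕ) (st : GState) : GFactor → GState
  | .gam t c s =>
    if t % 2 = 0 then
      let n := t / 2
      let st₁ := if n ≥ 1 then st.mulLins (intRange 1 (n - 1)) 0 (c : ℚ) s else st.mulLins (intRange n 0) 0 (c : ℚ) (-s)
      { st₁ with euler := st₁.euler - (s : ℚ) * (c : ℚ), logT := psAdd N st₁.logT (logGammaOne N (c : ℚ) s) }
    else
      let n := (t - 1) / 2
      let st₁ := if n ≥ 1 then st.mulLins (intRange 0 (n - 1)) (1 / 2) (c : ℚ) s
        else if n ≤ -1 then st.mulLins (intRange n (-1)) (1 / 2) (c : ℚ) (-s) else st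
      { st₁ with euler := st₁.euler - (s : ℚ) * (c : ℚ), logT := psAdd N st₁.logT (logGammaHalf N (c : ℚ) s) }
  | .twoPow a c =>
    { st with scale := st.scale * qzpow 2 a,
              logT := psAdd N st.logT ((List.range (N + 1)).map fun (k : ℕ) =>
                if k = 1 then [((c : ℚ), ({ ln2 := 1 } : Mono))] else []) }
  | .expEuler c => { st with euler := st.euler + (c : ℚ) }
  | .const q => { st with scale := st.scale * q }

/-- Net number of half-integer Γ's (with multiplicity and sign of the exponent): the dropped `Γ(½)` powers. [cite: AbramowitzStegun1964, 6.1.8] -/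
def halfBalance (fs : List GFactor) : ℤ :=
  fs.foldl (fun acc f => match f with
    | .gam t _ s => if t % 2 = 0 then acc else acc + s
    | _ => acc) 0

/-- The initial state. [cite: LeeSmirnov2011, §3] -/
def GState.init (N : ℕ) : GState := ⟨0, 1, [], [], 0, psZero N⟩

/-- THE ENGINE: the exact ε-expansion (orders `lo … lo+N`) of a γ_E-free, `Γ(½)`-balanced product of `GFactor`s, as an `ESeries`
in [LeeSmirnov2011]'s monomials; `none` if `γ_E` does not cancel or the `Γ(½)`'s do not balance (the engine represents neither).
Valid for `N ≤ 8` (ζ-table). [cite: BadgerEtAl2024, eqs. (4.23)–(4.24); AbramowitzStegun1964, 6.3.3, 6.4.4, 23.2.16] -/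
def gammaFormSeries (N : ℕ) (fs : List GFactor) : Option ESeries :=
  let st := fs.foldl (GState.step N) (GState.init N)
  if st.euler ≠ 0 ∨ halfBalance fs ≠ 0 then none else
    some ⟨st.shift, (psMulRat N (prefactorSeries (N + 1) (st.num, st.den)) (psExp N st.logT)).map
      fun c => collect (SCoeff.smul st.scale c)⟩

/-! ### 4. The printed Γ-closed forms -/

/-- [LeeSmirnov2011] §3, the Γ-closed masters AS PRINTED (each divided here by the paper's overall `Γ(1+ε)³`, last factor):
`G_{4,1} = Γ(5−6ε)Γ(1−ε)³Γ(2ε−1)Γ(3ε−2)/(Γ(4−4ε)Γ(3−3ε))`,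
`G_{4,2} = Γ(3−4ε)Γ(1−ε)²Γ(ε−1)Γ(ε)Γ(2ε−1)/(Γ(3−3ε)Γ(2−2ε))`,
`G_{4,4} = 2^{1−2ε}Γ(2−ε)Γ(ε−1)²Γ(ε−½)Γ(3ε−2)/Γ(2ε−½)`,
`G_{5,4} = Γ(3−6ε)Γ(1−ε)⁴Γ(ε)²Γ(3ε−1)/(Γ(3−4ε)Γ(2−2ε)²)` (arguments `t/2 + cε` encoded as `gam t c s`).
[cite: LeeSmirnov2011, §3, displays for G_{4,1}, G_{4,2}, G_{4,4}, G_{5,4}] -/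
def lsGammaForm : ℕ × ℕ → List GFactor
  | (4, 1) => [.gam 10 (-6) 1, .gam 2 (-1) 3, .gam (-2) 2 1, .gam (-4) 3 1, .gam 8 (-4) (-1), .gam 6 (-3) (-1), .gam 2 1 (-3)]
  | (4, 2) => [.gam 6 (-4) 1, .gam 2 (-1) 2, .gam (-2) 1 1, .gam 0 1 1, .gam (-2) 2 1, .gam 6 (-3) (-1), .gam 4 (-2) (-1),
      .gam 2 1 (-3)]
  | (4, 4) => [.twoPow 1 (-2), .gam 4 (-1) 1, .gam (-2) 1 2, .gam (-1) 1 1, .gam (-4) 3 1, .gam (-1) 2 (-1), .gam 2 1 (-3)]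
  | (5, 4) => [.gam 6 (-6) 1, .gam 2 (-1) 4, .gam 0 1 2, .gam (-2) 3 1, .gam 6 (-4) (-1), .gam 4 (-2) (-2), .gam 2 1 (-3)]
  | _ => []

/-- `Γ((a + b·d)/2)^s` with `a, b ∈ ℤ`, read at `d = 4 − 2ε`: `= Γ((a+4b)/2 − bε)^s`. [cite: SchroderVuorinen2005, §6.3 (d-dimensional forms)] -/
def gamD (a b s : ℤ) : GFactor := .gam (a + 4 * b) (-b) s

/-- [SchroderVuorinen2005] TeX l.1360–1362, AS PRINTED in `d` dimensions:
`threeBa/J³ = 2^{d−3} Γ((8−3d)/2) Γ((3−d)/2) Γ(d/2) / (Γ((7−2d)/2) Γ((2−d)/2))`, followed by `J³ ↦ Γ(ε−1)³` (the tadpole cubed in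
[LeeSmirnov2011]'s normalisation, `= G₃`) and the division by `Γ(1+ε)³`; `2^{d−3} = 2^{1−2ε}`.
[cite: SchroderVuorinen2005, §6.3, eq. for threeBa/J³] -/
def svThreeBaForm : List GFactor :=
  [.twoPow 1 (-2), gamD 8 (-3) 1, gamD 3 (-1) 1, gamD 0 1 1, gamD 7 (-2) (-1), gamD 2 (-1) (-1), .gam (-2) 1 3, .gam 2 1 (-3)]

/-- [BadgerEtAl2024] eq. (4.21) with eq. (4.27)'s `e^{εγ_E}`: `e^{εγ_E} Γ(1+ε) Γ(−ε)² / Γ(1−2ε)`. [cite: BadgerEtAl2024, eqs. (4.21), (4.27)] -/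
def badgerF3Form : List GFactor := [.expEuler 1, .gam 2 1 1, .gam 0 (-1) 2, .gam 2 (-2) (-1)]

/-- [BadgerEtAl2024] eq. (4.27), the bracket AS PRINTED: `1/ε² − π²/12 − (7/3)ζ₃ ε − (47π⁴/1440) ε² + O(ε³)`.
[cite: BadgerEtAl2024, eq. (4.27)] -/
def badgerF3Bracket : ESeries :=
  ⟨-2, [[((1 : ℚ), {})], [], [((-1/12 : ℚ), { pi := 2 })], [((-7/3 : ℚ), { z3 := 1 })], [((-47/1440 : ℚ), { pi := 4 })]]⟩

/-- `(e^{−γ_Eε}/Γ(1+ε))⁴`, the conversion factor of `FourLoopOnShellMasters.lean`, as a Γ-form. [cite: LeeMarquardSmirnovSmirnovSteinhauser2013, App. A, normalisation sentence] -/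
def lmsssConvForm : List GFactor := [.expEuler (-4), .gam 2 1 (-4)]

/-! ### 5. Kernel checks -/

/-- In all seven products the `γ_E ε` term of the exponent vanishes and the `Γ(½)`'s balance (the engine returns `some`).
[cite: BadgerEtAl2024, eq. (4.27) («in order to avoid the explicit appearance of γ_E»)] -/
theorem euler_cancels :
    ([lsGammaForm (4, 1), lsGammaForm (4, 2), lsGammaForm (4, 4), lsGammaForm (5, 4), svThreeBaForm, badgerF3Form,
      lmsssConvForm].map fun fs => (gammaFormSeries 7 fs).isSome) = [true, true, true, true, true, true, true] := by
  decide +kernel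

/-- LEE–SMIRNOV'S PRINTED Γ-CLOSED FORMS REPRODUCE THEIR PRINTED EXPANSIONS: for `G_{4,1}` (orders `ε⁻²…ε⁵`) and `G_{4,2}`, `G_{4,4}`,
`G_{5,4}` (orders `ε⁻³…ε⁴`) the exp–log expansion of the printed Γ-product over `Γ(1+ε)³` equals the printed `prefactor × {bracket}`
(`lsExpanded?`) monomial by monomial — 32 coefficients up to transcendental weight 7.
[cite: LeeSmirnov2011, §3, displays for G_{4,1}, G_{4,2}, G_{4,4}, G_{5,4}] -/
theorem ls_gamma_forms_reproduce_brackets :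
    ([(4, 1), (4, 2), (4, 4), (5, 4)].all fun g =>
      (List.range 8).all fun j =>
        let k : ℤ := (lsBracket g).lo + (j : ℤ)
        coeffAgree ((gammaFormSeries 7 (lsGammaForm g)).bind fun s => s.coeff? k) (lsExpanded? g k)) = true := by
  decide +kernel

/-- SCHRÖDER–VUORINEN'S `threeBa` IS LEE–SMIRNOV'S `G_{4,4}`: the printed `d`-dimensional Γ-form at `d = 4 − 2ε`, times `J³ = Γ(ε−1)³`,
over `Γ(1+ε)³`, equals `prefactor × {bracket}` of `G_{4,4}` at all eight printed orders `ε⁻³…ε⁴`.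
[cite: SchroderVuorinen2005, §6.3, eq. for threeBa/J³; LeeSmirnov2011, §3, display for G_{4,4}] -/
theorem sv_threeBa_form_is_ls_g44 :
    ((List.range 8).all fun j =>
      let k : ℤ := -3 + (j : ℤ)
      coeffAgree ((gammaFormSeries 7 svThreeBaForm).bind fun s => s.coeff? k) (lsExpanded? (4, 4) k)) = true := by
  decide +kernel

/-- The hand-typed `convFactor4 = (e^{−γ_Eε}/Γ(1+ε))⁴` through `ε⁷` of `FourLoopOnShellMasters.lean` is the exp–log series.
[cite: LeeMarquardSmirnovSmirnovSteinhauser2013, App. A, normalisation sentence] -/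
theorem lmsss_convFactor4_is_explog :
    ((List.range 8).all fun j =>
      coeffAgree ((gammaFormSeries 7 lmsssConvForm).bind fun s => s.coeff? (j : ℤ)) (convFactor4.coeff? (j : ℤ))) = true := by
  decide +kernel

/-- The textbook example: `e^{εγ_E}Γ(1+ε)Γ(−ε)²/Γ(1−2ε)` expands to eq. (4.27)'s bracket at its four printed orders `ε⁻²…ε²`
(the `ε¹` coefficient `−(7/3)ζ₃` and `ε²` coefficient `−47π⁴/1440` included). [cite: BadgerEtAl2024, eq. (4.27)] -/
theorem badger_F3_expansion :
    ((List.range 5).all fun j =>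
      let k : ℤ := -2 + (j : ℤ)
      coeffAgree ((gammaFormSeries 7 badgerF3Form).bind fun s => s.coeff? k) (badgerF3Bracket.coeff? k)) = true := by
  decide +kernel

/-- Reflection-formula sanity check of the engine: `Γ(1+ε)Γ(1−ε) = πε/ sin(πε) = 1 + (π²/6)ε² + (7π⁴/360)ε⁴ + (31π⁶/15120)ε⁶ + O(ε⁸)`,
the bracket typed from the sine series. [cite: AbramowitzStegun1964, 6.1.17 and 4.3.68] -/
def reflectionBracket : ESeries :=
  ⟨0, [[((1 : ℚ), {})], [], [((1/6 : ℚ), { pi := 2 })], [], [((7/360 : ℚ), { pi := 4 })], [], [((31/15120 : ℚ), { pi := 6 })]]⟩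

/-- The engine reproduces `Γ(1+ε)Γ(1−ε) = πε/sin(πε)` through `ε⁶` (even zetas `ζ₂, ζ₄, ζ₆` and the exponential combine correctly).
[cite: AbramowitzStegun1964, 6.1.17] -/
theorem reflection_check :
    ((List.range 7).all fun j =>
      coeffAgree ((gammaFormSeries 7 [.gam 2 1 1, .gam 2 (-1) 1]).bind fun s => s.coeff? (j : ℤ))
        (reflectionBracket.coeff? (j : ℤ))) = true := by
  decide +kernel

/-- Non-vacuity control: the same comparison FAILS when the Γ-form of `G_{4,4}` is set against the printed expansion of `G_{4,2}`
(they share the prefactor and the leading power but differ from `ε⁻³` on). [cite: LeeSmirnov2011, §3, displays for G_{4,2}, G_{4,4}] -/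
theorem ls_g44_form_is_not_g42 :
    ((List.range 8).all fun j =>
      let k : ℤ := -3 + (j : ℤ)
      coeffAgree ((gammaFormSeries 7 (lsGammaForm (4, 4))).bind fun s => s.coeff? k) (lsExpanded? (4, 2) k)) = false := by
  decide +kernel

end Literature.MathematicalPhysics.QuantumFieldTheory.LeeSmirnov2011
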